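import Summits.CriticalPhenomena.PercolationContinuityZ3.Theorems.Transplant.KNParaChainSchedN
import Summits.CriticalPhenomena.PercolationContinuityZ3.Theorems.Transplant.KNParaChainParkN
import HarnessLib

/-!
# N2 (frames-only node `SamePDropOfSkeletonFrm₁`, OPEN), LEVEL 1, (C) column: the planar schedule with slab targets AND PARKING —
# `ChainPlanar.ScheduleNP` (= `ScheduleN` with the route property relaxed to the far/stride DICHOTOMY: a point of the enlarged core whose `ρ`-box
# already lies in the next core need not stride) and the parking phase `ChainPara.ParkPrm` AS such a schedule (`ParkPrm.scheduleNP`); every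
# `ScheduleN` is a `ScheduleNP` (`ScheduleN.toNP`) — pure `Site 2`

builds on p205010 (kernel theorem, internal audit signed; external expert review pending) — nothing in this file uses p205010; nothing here is a
claim about the open node `SamePDropOfSkeletonFrm₁`.
Lane `prim-bschramm`, seat `prim-bschramm-p5` (gen 15; (C) lineage; B9-CORRIDOR-BOX.md §A3: under orientation the corridor's arrival is by parking);
helper file (`--supports stmt-CriticalPhenomena-4575`).

WHY.  `ScheduleN.route` (KNParaChainSchedN :154) asks a stride from EVERY point of the `R'`-enlarged core into the next core; a parking step cannot
offer that near its far edge (the stride would overshoot) and does not need it: the (S0) kit clause `kitClauseF` serves a near contact EITHER by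
`∃ u ∈ Λc (ctCtr x) kz, u ∈ T` (its zone box meets the target) OR by a route.  `ScheduleNP.routeP` is exactly that disjunction at the planar level,
with `ρ` = the planar radius of the zone box; the window chain's geometric fields (`ax lo hi region prism N R' encl succ sub_prism nonempty`) are
`ScheduleN`'s VERBATIM, so `SchedFrame`/`stepDF`/`coreTF`/`stepLF`/`stepAF`/`kitsAt_stepAF` (SkelPhiWinChainF) apply unchanged through `toFrame`.
* §1 **`ScheduleNP`**, `core/level/InPiece`, `level_zero`, `level_mono`, `level_subset_region`, **`routeP_level`**, **`ScheduleN.toNP`** (+ `toNP_*` rfl API);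
* §2 **`ChainPara.ParkPrm.scheduleNP`** (axis `a`, sign `σ`, origin `c`; `R' := ea = eb`), `pcore/pregion/pprism`, `mem_pcore_iff/…`, `scheduleNP_core_zero`.
[cite: MartineauTassion2017, §4.3 Lemma 4.2] [cite: KozmaNitzan2024, §4 Lemma 11 (pp. 22–23), Lemma 12 (pp. 23–25)]
-/

noncomputable section

namespace Summit.CriticalPhenomena.PercolationContinuityZ3.Theorems

namespace Transplant

namespace ChainPlanar

open Literature.Probability.Percolation Literature.Probability.LatticeModels
open Literature.Probability.Percolation.KozmaNitzan
open Literature.Probability.Percolation.KozmaNitzan.Cells (oth oth_ne eq_oth_of_ne)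

/-! ## §1 Schedules with slab targets and parking -/

/-- **A planar schedule of `N + 1` steps with slab targets AND PARKING**: the fields of `ScheduleN` with the route property relaxed — from every point
`v` of the `R'`-enlarged core `k` there is a sign `σ = ±1` such that the link box lies in `region k` and EITHER the `ρ`-box `Icc (v − ρ) (v + ρ)` lies in
the next core (the contact PARKS: its zone box meets the target) OR, for a sign `τ`, every `y` of the along-slab `sLo k ≤ σ(y_a − v_a) ≤ sHi k` whose
signed transverse offset minus the drift lies in the piece of sign `τ` lies in the next core. [cite: MartineauTassion2017, §4.3 Lemma 4.2]
[cite: KozmaNitzan2024, §4 Lemma 12 (pp. 23–25)] [this work] -/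
structure ScheduleNP where
  /-- the axis of step `k` -/
  ax : ℕ → Fin 2
  /-- lower corner of core `k` -/
  lo : ℕ → Site 2
  /-- upper corner of core `k` -/
  hi : ℕ → Site 2
  /-- the region of step `k` -/
  region : ℕ → Finset (Site 2)
  /-- one planar box holding every region -/
  prism : Finset (Site 2)
  /-- the steps are `0, …, N` -/
  N : ℕ
  /-- the planar neighbourhood radius (level depth `+ 1`, kit-centre displacement) -/
  R' : ℕ
  /-- the planar radius of a contact's zone box (the parking test) -/
  ρ : ℕ
  /-- minimal along-progress of the stride of step `k` -/
  sLo : ℕ → ℤ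
  /-- maximal along-progress of the stride of step `k` -/
  sHi : ℕ → ℤ
  /-- transverse drift of the stride of step `k` -/
  d : ℕ → ℤ
  /-- the `τ = 1` piece of step `k` is `[0, Pp k]` -/
  Pp : ℕ → ℕ
  /-- the `τ = −1` piece of step `k` is `[−Pm k, 0]` -/
  Pm : ℕ → ℕ
  /-- along half-size of the link box of step `k` -/
  La : ℕ → ℕ
  /-- transverse half-size of the link box of step `k` -/
  Lb : ℕ → ℕ
  /-- the `R'`-enlarged core lies in the region -/
  encl : ∀ k ≤ N, Finset.Icc (lo k - ((R' : ℕ) : Site 2)) (hi k + ((R' : ℕ) : Site 2)) ⊆ region k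
  /-- the next core lies in the region -/
  succ : ∀ k ≤ N, Finset.Icc (lo (k + 1)) (hi (k + 1)) ⊆ region k
  /-- every region lies in the prism -/
  sub_prism : ∀ k ≤ N, region k ⊆ prism
  /-- every core is nonempty -/
  nonempty : ∀ k ≤ N + 1, (Finset.Icc (lo k) (hi k)).Nonempty
  /-- the route property WITH PARKING (far/stride dichotomy) -/
  routeP : ∀ k ≤ N, ∀ v ∈ Finset.Icc (lo k - ((R' : ℕ) : Site 2)) (hi k + ((R' : ℕ) : Site 2)), ∃ σ : ℤ, (σ = 1 ∨ σ = -1) ∧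
    (∀ y : Site 2, |y (ax k) - v (ax k)| ≤ La k → |y (oth (ax k)) - v (oth (ax k))| ≤ Lb k → y ∈ region k) ∧
    (Finset.Icc (v - ((ρ : ℕ) : Site 2)) (v + ((ρ : ℕ) : Site 2)) ⊆ Finset.Icc (lo (k + 1)) (hi (k + 1)) ∨
     ∃ τ : ℤ, (τ = 1 ∨ τ = -1) ∧ ∀ y : Site 2, sLo k ≤ σ * (y (ax k) - v (ax k)) → σ * (y (ax k) - v (ax k)) ≤ sHi k →
      ((τ = 1 → 0 ≤ σ * (y (oth (ax k)) - v (oth (ax k))) - d k ∧ σ * (y (oth (ax k)) - v (oth (ax k))) - d k ≤ Pp k) ∧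
       (τ = -1 → -(Pm k : ℤ) ≤ σ * (y (oth (ax k)) - v (oth (ax k))) - d k ∧ σ * (y (oth (ax k)) - v (oth (ax k))) - d k ≤ 0)) →
      y ∈ Finset.Icc (lo (k + 1)) (hi (k + 1)))

namespace ScheduleNP

variable (S : ScheduleNP)

/-- Core `k` of the schedule. [folklore] -/
def core (k : ℕ) : Finset (Site 2) := Finset.Icc (S.lo k) (S.hi k)

/-- Level `j` of step `k`: the `j`-enlargement of core `k`. [cite: KozmaNitzan2024, §4 p. 15 (B⟨j⟩)] -/
def level (k j : ℕ) : Finset (Site 2) := Finset.Icc (S.lo k - ((j : ℕ) : Site 2)) (S.hi k + ((j : ℕ) : Site 2))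

/-- The landing piece of sign `τ` at step `k`, as a predicate on the signed transverse offset `δ`. [cite: MartineauTassion2017, §3.2] -/
def InPiece (k : ℕ) (τ δ : ℤ) : Prop := (τ = 1 → 0 ≤ δ ∧ δ ≤ S.Pp k) ∧ (τ = -1 → -(S.Pm k : ℤ) ≤ δ ∧ δ ≤ 0)

/-- Level `0` is the core. [folklore] -/
theorem level_zero (k : ℕ) : ScheduleNP.level S k 0 = Finset.Icc (S.lo k) (S.hi k) := by
  simp [level]

/-- Levels grow. [folklore] -/
theorem level_mono (k : ℕ) {j j' : ℕ} (h : j ≤ j') :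
    Finset.Icc (S.lo k - ((j : ℕ) : Site 2)) (S.hi k + ((j : ℕ) : Site 2)) ⊆ ScheduleNP.level S k j' := by
  refine Finset.Icc_subset_Icc (fun i => ?_) (fun i => ?_) <;>
    simp only [Pi.sub_apply, Pi.add_apply, Pi.natCast_apply] <;> omega

/-- Levels `j ≤ R'` of step `k ≤ N` lie in the region. [cite: KozmaNitzan2024, §4 Lemma 10 (p. 17: B⟨R+1⟩ ⊆ D)] -/
theorem level_subset_region {k : ℕ} (hk : k ≤ S.N) {j : ℕ} (hj : j ≤ S.R') :
    Finset.Icc (S.lo k - ((j : ℕ) : Site 2)) (S.hi k + ((j : ℕ) : Site 2)) ⊆ ScheduleNP.region S k :=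
  (S.level_mono k hj).trans (S.encl k hk)

/-- **The route dichotomy from every point of a level `j ≤ R'`.** [cite: MartineauTassion2017, §4.3 Lemma 4.2] [cite: KozmaNitzan2024, §4 Lemma 12 (pp. 23–25)] -/
theorem routeP_level {k : ℕ} (hk : k ≤ S.N) {j : ℕ} (hj : j ≤ S.R') {v : Site 2} (hv : v ∈ S.level k j) :
    ∃ σ : ℤ, (σ = 1 ∨ σ = -1) ∧
      (∀ y : Site 2, |y (S.ax k) - v (S.ax k)| ≤ S.La k → |y (oth (S.ax k)) - v (oth (S.ax k))| ≤ S.Lb k → y ∈ S.region k) ∧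
      (Finset.Icc (v - ((S.ρ : ℕ) : Site 2)) (v + ((S.ρ : ℕ) : Site 2)) ⊆ S.core (k + 1) ∨
       ∃ τ : ℤ, (τ = 1 ∨ τ = -1) ∧ ∀ y : Site 2, S.sLo k ≤ σ * (y (S.ax k) - v (S.ax k)) → σ * (y (S.ax k) - v (S.ax k)) ≤ S.sHi k →
        S.InPiece k τ (σ * (y (oth (S.ax k)) - v (oth (S.ax k))) - S.d k) → y ∈ S.core (k + 1)) :=
  S.routeP k hk v (S.level_mono k hj hv)

end ScheduleNP

/-- **Every schedule with slab targets is a schedule with parking** (the stride branch everywhere; `ρ := 0`). [folklore] -/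
def ScheduleN.toNP (S : ScheduleN) : ScheduleNP where
  ax := S.ax
  lo := S.lo
  hi := S.hi
  region := S.region
  prism := S.prism
  N := S.N
  R' := S.R'
  ρ := 0
  sLo := S.sLo
  sHi := S.sHi
  d := S.d
  Pp := S.Pp
  Pm := S.Pm
  La := S.La
  Lb := S.Lb
  encl := S.encl
  succ := S.succ
  sub_prism := S.sub_prism
  nonempty := S.nonempty
  routeP k hk v hv := by
    obtain ⟨σ, hσ, hreg, τ, hτ, hroute⟩ := S.route k hk v hv
    exact ⟨σ, hσ, hreg, Or.inr ⟨τ, hτ, hroute⟩⟩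

/-- The geometric fields of `toNP` are those of the schedule. [folklore] -/
theorem ScheduleN.toNP_spec (S : ScheduleN) :
    S.toNP.ax = S.ax ∧ S.toNP.lo = S.lo ∧ S.toNP.hi = S.hi ∧ S.toNP.region = S.region ∧ S.toNP.prism = S.prism ∧ S.toNP.N = S.N ∧
      S.toNP.R' = S.R' ∧ S.toNP.ρ = 0 := ⟨rfl, rfl, rfl, rfl, rfl, rfl, rfl, rfl⟩

end ChainPlanar

/-! ## §2 The parking phase as a schedule with slab targets and parking -/

namespace ChainPara

open Literature.Probability.Percolation Literature.Probability.LatticeModels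
open Literature.Probability.Percolation.KozmaNitzan.Cells (oth oth_ne eq_oth_of_ne)
open ChainPlanar

namespace ParkPrm

/-- Core `k` of the parking phase rendered on the plane: axis `a`, sign `σ`, origin `c`. [this work] -/
def pcore (P : ParkPrm) (a : Fin 2) (σ : ℤ) (c : Site 2) (k : ℕ) : Finset (Site 2) := dBox a σ c (P.aLo k) (P.aHi k) (P.bLo k) (P.bHi k)

/-- Region `k` of the parking phase rendered on the plane. [this work] -/
def pregion (P : ParkPrm) (a : Fin 2) (σ : ℤ) (c : Site 2) (k : ℕ) : Finset (Site 2) :=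
  dBox a σ c (P.aLo k - P.ea - P.La) (P.aHi k + P.ea + P.La) (P.bLo k - P.eb - P.Lb) (P.bHi k + P.eb + P.Lb)

/-- The prism of the parking phase rendered on the plane. [this work] -/
def pprism (P : ParkPrm) (a : Fin 2) (σ : ℤ) (c : Site 2) : Finset (Site 2) :=
  dBox a σ c (P.aBot - P.ea - P.La) (P.A + (P.N : ℤ) * (P.ea + P.ρ) + P.ea + P.La)
    (-(P.Wm : ℤ) - (P.N : ℤ) * P.g - P.eb - P.Lb) ((P.Wp : ℤ) + (P.N : ℤ) * P.g + P.eb + P.Lb)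

variable {P : ParkPrm} {a : Fin 2} {σ : ℤ} {c : Site 2}

/-- Planar membership in a core = parking-coordinate membership. [folklore] -/
theorem mem_pcore_iff (hσ : σ = 1 ∨ σ = -1) {k : ℕ} {y : Site 2} :
    y ∈ P.pcore a σ c k ↔ ParkPrm.InCore P k (σ * (y a - c a)) (σ * (y (oth a) - c (oth a))) := by
  rw [pcore, mem_dBox_iff hσ]; simp only [InCore]; tauto

/-- Planar membership in a region = parking-coordinate membership. [folklore] -/
theorem mem_pregion_iff (hσ : σ = 1 ∨ σ = -1) {k : ℕ} {y : Site 2} :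
    y ∈ P.pregion a σ c k ↔ ParkPrm.InRegion P k (σ * (y a - c a)) (σ * (y (oth a) - c (oth a))) := by
  rw [pregion, mem_dBox_iff hσ]; simp only [InRegion]; tauto

/-- Planar membership in the prism = parking-coordinate membership. [folklore] -/
theorem mem_pprism_iff (hσ : σ = 1 ∨ σ = -1) {y : Site 2} :
    y ∈ P.pprism a σ c ↔ ParkPrm.InPrism P (σ * (y a - c a)) (σ * (y (oth a) - c (oth a))) := by
  rw [pprism, mem_dBox_iff hσ]; simp only [InPrism]; tauto

/-- Planar membership in the `ea`-enlarged core = parking-coordinate membership in the enlarged core (`eb = ea`). [folklore] -/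
theorem mem_enlarge_iff (hσ : σ = 1 ∨ σ = -1) (heb : P.eb = P.ea) {k : ℕ} {y : Site 2} :
    y ∈ dBox a σ c (P.aLo k - P.ea) (P.aHi k + P.ea) (P.bLo k - P.ea) (P.bHi k + P.ea) ↔
      P.InEnl k (σ * (y a - c a)) (σ * (y (oth a) - c (oth a))) := by
  rw [mem_dBox_iff hσ]; simp only [InEnl, heb]; tauto

/-- Signed coordinate differences relative to the origin and relative to a point. [folklore] -/
theorem sub_sub_eq (σ : ℤ) (y v c : Site 2) (i : Fin 2) : σ * (y i - c i) - σ * (v i - c i) = σ * (y i - v i) := by ring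

/-- **THE PARKING PHASE AS A SCHEDULE WITH SLAB TARGETS AND PARKING** (axis `a`, sign `σ`, origin `c`; `R' := ea = eb`, `ρ := P.ρ`).
[cite: MartineauTassion2017, §4.3 Lemma 4.2] [cite: KozmaNitzan2024, §4 Lemma 12 (pp. 23–25)] -/
def scheduleNP (P : ParkPrm) (a : Fin 2) {σ : ℤ} (hσ : σ = 1 ∨ σ = -1) (c : Site 2) (hP : ParkOK P) (heb : P.eb = P.ea) : ScheduleNP where
  ax := fun _ => a
  lo := fun k => dLo a σ c (P.aLo k) (P.aHi k) (P.bLo k) (P.bHi k)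
  hi := fun k => dHi a σ c (P.aLo k) (P.aHi k) (P.bLo k) (P.bHi k)
  region := fun k => P.pregion a σ c k
  prism := P.pprism a σ c
  N := P.N
  R' := P.ea
  ρ := P.ρ
  sLo := fun _ => P.sLo
  sHi := fun _ => P.sHi
  d := fun _ => P.d
  Pp := fun _ => P.Pp
  Pm := fun _ => P.Pm
  La := fun _ => P.La
  Lb := fun _ => P.Lb
  encl k _ := by
    rw [dBox_enlarge hσ]
    intro y hy
    exact (mem_pregion_iff hσ).2 (inRegion_of_inEnl ((mem_enlarge_iff hσ heb).1 hy))
  succ k _ := by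
    intro y hy
    exact (mem_pregion_iff hσ).2 (inRegion_of_inCore_succ hP ((mem_pcore_iff hσ).1 hy) (aLo_le_aHi hP k))
  sub_prism k hk := by
    intro y hy
    exact (mem_pprism_iff hσ).2 (inPrism_of_inRegion hP hk ((mem_pregion_iff hσ).1 hy))
  nonempty k _ := by
    have h := inCore_far_corner hP k
    exact dBox_nonempty hσ c (h.1.trans h.2.1) (h.2.2.1.trans h.2.2.2)
  routeP k _ v hv := by
    rw [dBox_enlarge hσ] at hv
    have hv' := (mem_enlarge_iff hσ heb).1 hv
    have habs : |σ| = 1 := by rcases hσ with h | h <;> simp [h]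
    obtain ⟨hreg, hfar, hstr⟩ := route hP hv'
    refine ⟨σ, hσ, fun y hya hyb => (mem_pregion_iff hσ).2 (hreg _ _ ?_ ?_), ?_⟩
    · rw [sub_sub_eq, abs_mul, habs, one_mul]; exact hya
    · rw [sub_sub_eq, abs_mul, habs, one_mul]; exact hyb
    by_cases hf : P.IsFar k (σ * (v a - c a))
    · -- the contact parks: its ρ-box lies in the next core
      refine Or.inl fun y hy => ?_
      rw [Finset.mem_Icc] at hy
      have hya : |y a - v a| ≤ P.ρ := by
        rw [abs_le]; have h1 := hy.1 a; have h2 := hy.2 a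
        simp only [Pi.sub_apply, Pi.add_apply, Pi.natCast_apply] at h1 h2; constructor <;> linarith
      have hyb : |y (oth a) - v (oth a)| ≤ P.ρ := by
        rw [abs_le]; have h1 := hy.1 (oth a); have h2 := hy.2 (oth a)
        simp only [Pi.sub_apply, Pi.add_apply, Pi.natCast_apply] at h1 h2; constructor <;> linarith
      refine (mem_pcore_iff hσ).2 (hfar hf _ _ ?_ ?_)
      · rw [sub_sub_eq, abs_mul, habs, one_mul]; exact hya
      · rw [sub_sub_eq, abs_mul, habs, one_mul]; exact hyb
    · -- the contact strides
      refine Or.inr ⟨P.steer k (σ * (v (oth a) - c (oth a))), P.steer_eq_or k _, fun y h1 h2 hpc => (mem_pcore_iff hσ).2 (hstr hf _ _ ?_ ?_ ?_)⟩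
      · rw [sub_sub_eq]; exact h1
      · rw [sub_sub_eq]; exact h2
      · have : σ * (y (oth a) - c (oth a)) - σ * (v (oth a) - c (oth a)) - P.d = σ * (y (oth a) - v (oth a)) - P.d := by ring
        rw [this]; exact hpc

/-- The geometric parameters of `scheduleNP`. [folklore] -/
theorem scheduleNP_params (P : ParkPrm) (a : Fin 2) {σ : ℤ} (hσ : σ = 1 ∨ σ = -1) (c : Site 2) (hP : ParkOK P) (heb : P.eb = P.ea) :
    (P.scheduleNP a hσ c hP heb).N = P.N ∧ (P.scheduleNP a hσ c hP heb).R' = P.ea ∧ (P.scheduleNP a hσ c hP heb).ρ = P.ρ ∧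
      (∀ k, (P.scheduleNP a hσ c hP heb).ax k = a) ∧ (∀ k, (P.scheduleNP a hσ c hP heb).region k = P.pregion a σ c k) ∧
      (P.scheduleNP a hσ c hP heb).prism = P.pprism a σ c := ⟨rfl, rfl, rfl, fun _ => rfl, fun _ => rfl, rfl⟩

/-- Core `k` of `scheduleNP` is the rendered core. [folklore] -/
theorem scheduleNP_core (P : ParkPrm) (a : Fin 2) {σ : ℤ} (hσ : σ = 1 ∨ σ = -1) (c : Site 2) (hP : ParkOK P) (heb : P.eb = P.ea) (k : ℕ) :
    (P.scheduleNP a hσ c hP heb).core k = P.pcore a σ c k := rfl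

/-- Membership in core `0` of `scheduleNP`: the start box `[aLo0, A] × [−Wm, Wp]` in parking coordinates. [folklore] -/
theorem mem_scheduleNP_core_zero (P : ParkPrm) (a : Fin 2) {σ : ℤ} (hσ : σ = 1 ∨ σ = -1) (c : Site 2) (hP : ParkOK P) (heb : P.eb = P.ea)
    {y : Site 2} : y ∈ (P.scheduleNP a hσ c hP heb).core 0 ↔
      P.aLo0 ≤ σ * (y a - c a) ∧ σ * (y a - c a) ≤ P.A ∧ -(P.Wm : ℤ) ≤ σ * (y (oth a) - c (oth a)) ∧ σ * (y (oth a) - c (oth a)) ≤ P.Wp := by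
  rw [scheduleNP_core, mem_pcore_iff hσ, inCore_zero_iff]

end ParkPrm

end ChainPara

end Transplant

end Summit.CriticalPhenomena.PercolationContinuityZ3.Theorems

end
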